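import Mathlib
import Literature.Analysis.FunctionSpaces.SmoothParametricIntegral
import HarnessLib

/-!
# Crux `EulerZoomLiouville.PowerGaugeEulerLiouville` (stmt-NavierStokesRegularity-19832), line `pressure-floor`, stub A2 — brick 2:
# THE CUT-OFF DENSITY AND THE SHELL TRANSFORM (radial Poisson equation in the variable `σ = |x|²`)

Route №10 `EulerZoomLiouville` (NavierStokesRegularity), crux E.  Line `pressure-floor` (ideator ns-idea-11;
`Cruxes/PowerGaugeEulerLiouville/Lines/pressure_floor.lean`), registered stub `stub_newtonianBumps` (A2): the Newtonian bump
family.  Seat ns-ezl-w3 (width seat W-PF1/A2, DIRECTOR-NS #162); brick 1 is ns-sfl-p1's `…PressureFloorShellMean` (shell-mean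
bounds + pinching algebra).  Writing the bump as `Ψ_R(x) = g(|x|²)`, the radial Poisson equation `ΔΨ_R = ρ(|x|²)` reads
`4σ g''(σ) + 6 g'(σ) = ρ(σ)` (tree `RadialCalculus.laplacian_comp_norm_sq`, `d = 3`), and is solved by the SHELL TRANSFORM
`g'(σ) = h(σ) := ½ ∫₀¹ t² ρ(σ t²) dt` (`= F(r)/(2r³)`).  This file is the one-variable calculus of `ρ` and `h` (theorems
only, no definitions — `ρ` and `h` enter as hypotheses `hh : h = fun σ => …`):

* `exists_cutDensity` — for `β ≥ 0`, `R ≥ 1` a SMOOTH, COMPACTLY SUPPORTED density `ρ : ℝ → ℝ` with `0 ≤ ρ`, `ρ(σ) ≤ (1+σ)^{−β/2}`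
  for `σ ≥ 0`, `ρ(σ) = (1+σ)^{−β/2}` on `[0, R²]` and `ρ(σ) = 0` for `σ ≥ 2R²` (two `Real.smoothTransition` cut-offs: one at
  `σ ∈ [R², 2R²]`, one at `σ ∈ [−3/4, −1/2]` hiding the singularity of `(1+σ)^{−β/2}` at `σ = −1`, invisible on `σ ≥ 0`);
* `contDiff_shellTransform` — `h` is smooth (tree `SmoothParametricIntegral.contDiff_parametric_intervalIntegral`);
* `deriv_shellTransform` — `h'(σ) = ½ ∫₀¹ t⁴ ρ'(σt²) dt` (one derivative under the integral sign);
* `shellTransform_ode` — **`4σ h'(σ) + 6 h(σ) = ρ(σ)` for every `σ`** (the integrand of `4σh' + 6h` is `d/dt [t³ ρ(σt²)]`; FTC);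
* `shellTransform_nonneg`, `two_mul_shellTransform_le_shellMean`, `two_mul_shellTransform_eq_shellMean`,
  `shellTransform_le_sixth` — sign, comparison with the shell mean `∫₀¹ t²(1+σt²)^{−β/2} dt` of brick 1, and the crude bound
  `h ≤ 1/6`.

WHAT THIS IS NOT: not NS, not the crux — a helper `--supports` stmt-19832 on the line `pressure-floor` (pure real analysis;
19832 is a crux CLASS of Euler/NS strata and stays OPEN; nothing here bears on NS regularity). [folklore]
-/

noncomputable section

-- flat `Theorems/<Route><Decl>…` files of one crux share the namespace of the crux (tree convention)
set_option linter.dupNamespace false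

open MeasureTheory Set Filter Topology intervalIntegral
open scoped ContDiff Topology

namespace Summit.NavierStokesRegularity.NavierStokesRegularity.Theorems.PowerGaugeEulerLiouville.PressureFloor

open Literature.Analysis.FunctionSpaces

/-! ### The cut-off density in the variable `σ = |x|²` -/

/-- **The cut-off density.**  For `β ≥ 0` and `R ≥ 1` there is a smooth compactly supported `ρ : ℝ → ℝ` with `0 ≤ ρ`
everywhere, `ρ(σ) ≤ (1+σ)^{−β/2}` for `σ ≥ 0`, `ρ(σ) = (1+σ)^{−β/2}` for `0 ≤ σ ≤ R²`, and `ρ(σ) = 0` for `σ ≥ 2R²`.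
Construction: `ρ(σ) = η(σ) · (1+σ)^{−β/2} · χ(σ)` with `η(σ) = smoothTransition(4σ+3)` (`= 0` for `σ ≤ −3/4`, `= 1` for
`σ ≥ −1/2`) and `χ(σ) = smoothTransition(2 − σ/R²)` (`= 1` for `σ ≤ R²`, `= 0` for `σ ≥ 2R²`). [folklore] -/
theorem exists_cutDensity {β : ℝ} (hβ : 0 ≤ β) {R : ℝ} (hR : 1 ≤ R) :
    ∃ ρ : ℝ → ℝ, ContDiff ℝ ∞ ρ ∧ HasCompactSupport ρ ∧ (∀ σ, 0 ≤ ρ σ) ∧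
      (∀ σ, 0 ≤ σ → ρ σ ≤ (1 + σ) ^ (-(β / 2))) ∧
      (∀ σ, 0 ≤ σ → σ ≤ R ^ 2 → ρ σ = (1 + σ) ^ (-(β / 2))) ∧
      (∀ σ, 2 * R ^ 2 ≤ σ → ρ σ = 0) := by
  have _hβ := hβ
  have hR2 : 0 < R ^ 2 := by positivity
  -- the two cut-offs and the profile
  have hηs : ContDiff ℝ ∞ fun σ : ℝ => Real.smoothTransition (4 * σ + 3) :=
    Real.smoothTransition.contDiff.comp ((contDiff_const.mul contDiff_id).add contDiff_const)
  have hχs : ContDiff ℝ ∞ fun σ : ℝ => Real.smoothTransition (2 - σ / R ^ 2) :=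
    Real.smoothTransition.contDiff.comp (contDiff_const.sub (contDiff_id.div_const _))
  have hη0 : ∀ σ : ℝ, σ ≤ -3 / 4 → Real.smoothTransition (4 * σ + 3) = 0 := fun σ hσ =>
    Real.smoothTransition.zero_of_nonpos (by linarith)
  have hη1 : ∀ σ : ℝ, 0 ≤ σ → Real.smoothTransition (4 * σ + 3) = 1 := fun σ hσ =>
    Real.smoothTransition.one_of_one_le (by linarith)
  have hχ1 : ∀ σ : ℝ, σ ≤ R ^ 2 → Real.smoothTransition (2 - σ / R ^ 2) = 1 := fun σ hσ => by
    refine Real.smoothTransition.one_of_one_le ?_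
    have : σ / R ^ 2 ≤ 1 := (div_le_one hR2).2 hσ
    linarith
  have hχ0 : ∀ σ : ℝ, 2 * R ^ 2 ≤ σ → Real.smoothTransition (2 - σ / R ^ 2) = 0 := fun σ hσ => by
    refine Real.smoothTransition.zero_of_nonpos ?_
    have : 2 ≤ σ / R ^ 2 := (le_div_iff₀ hR2).2 (by linarith)
    linarith
  refine ⟨fun σ => Real.smoothTransition (4 * σ + 3) * (1 + σ) ^ (-(β / 2)) *
      Real.smoothTransition (2 - σ / R ^ 2), ?_, ?_, ?_, ?_, ?_, ?_⟩
  · -- smoothness: near `σ < -3/4` the function vanishes identically; elsewhere `1 + σ ≠ 0`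
    refine contDiff_iff_contDiffAt.2 fun σ => ?_
    by_cases hσ : σ < -3 / 4
    · have hev : (fun σ : ℝ => Real.smoothTransition (4 * σ + 3) * (1 + σ) ^ (-(β / 2)) *
          Real.smoothTransition (2 - σ / R ^ 2)) =ᶠ[𝓝 σ] fun _ => 0 := by
        filter_upwards [Iio_mem_nhds hσ] with τ hτ
        rw [hη0 τ (le_of_lt hτ), zero_mul, zero_mul]
      exact contDiffAt_const.congr_of_eventuallyEq hev
    · have hσ1 : (1 + σ) ≠ 0 := by linarith
      have h2 : ContDiffAt ℝ ∞ (fun σ : ℝ => (1 + σ) ^ (-(β / 2))) σ :=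
        (contDiffAt_const.add contDiffAt_id).rpow_const_of_ne hσ1
      exact (hηs.contDiffAt.mul h2).mul hχs.contDiffAt
  · -- compact support inside `[-3/4, 2R²]`
    refine HasCompactSupport.intro (isCompact_Icc : IsCompact (Icc (-3 / 4 : ℝ) (2 * R ^ 2))) fun σ hσ => ?_
    rw [mem_Icc, not_and_or, not_le, not_le] at hσ
    rcases hσ with hσ | hσ
    · rw [hη0 σ hσ.le, zero_mul, zero_mul]
    · rw [hχ0 σ hσ.le, mul_zero]
  · -- nonnegativity
    intro σ
    dsimp only
    by_cases hσ : σ ≤ -3 / 4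
    · rw [hη0 σ hσ, zero_mul, zero_mul]
    · have hpos : 0 < 1 + σ := by linarith
      exact mul_nonneg (mul_nonneg (Real.smoothTransition.nonneg _) (Real.rpow_nonneg hpos.le _))
        (Real.smoothTransition.nonneg _)
  · -- domination by the profile on `σ ≥ 0`
    intro σ hσ
    dsimp only
    have hW : 0 ≤ (1 + σ) ^ (-(β / 2)) := Real.rpow_nonneg (by linarith) _
    rw [hη1 σ hσ, one_mul]
    calc (1 + σ) ^ (-(β / 2)) * Real.smoothTransition (2 - σ / R ^ 2)
        ≤ (1 + σ) ^ (-(β / 2)) * 1 := mul_le_mul_of_nonneg_left (Real.smoothTransition.le_one _) hW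
      _ = (1 + σ) ^ (-(β / 2)) := mul_one _
  · -- equality with the profile on `[0, R²]`
    intro σ hσ0 hσR
    dsimp only
    rw [hη1 σ hσ0, hχ1 σ hσR, one_mul, mul_one]
  · -- vanishing beyond `2R²`
    intro σ hσ
    dsimp only
    rw [hχ0 σ hσ, mul_zero]

/-! ### The shell transform `h(σ) = ½ ∫₀¹ t² ρ(σt²) dt` -/

section ShellTransform

variable {ρ h : ℝ → ℝ}

/-- The joint integrand `(t, σ) ↦ t² ρ(σ t²)` is smooth for smooth `ρ`. [folklore] -/
theorem contDiff_shellIntegrand (hρ : ContDiff ℝ ∞ ρ) :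
    ContDiff ℝ ∞ fun q : ℝ × ℝ => q.1 ^ 2 * ρ (q.2 * q.1 ^ 2) :=
  (contDiff_fst.pow 2).mul (hρ.comp (contDiff_snd.mul (contDiff_fst.pow 2)))

/-- **The shell transform is smooth** (smooth dependence of `∫₀¹ t² ρ(σt²) dt` on the parameter `σ`; tree
`contDiff_parametric_intervalIntegral`). [folklore] -/
theorem contDiff_shellTransform (hρ : ContDiff ℝ ∞ ρ)
    (hh : h = fun σ => 2⁻¹ * ∫ t in (0 : ℝ)..1, t ^ 2 * ρ (σ * t ^ 2)) : ContDiff ℝ ∞ h := by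
  rw [hh]
  exact contDiff_const.mul
    (contDiff_parametric_intervalIntegral (H := fun q : ℝ × ℝ => q.1 ^ 2 * ρ (q.2 * q.1 ^ 2))
      (contDiff_shellIntegrand hρ) 0 1)

/-- The partial derivative of the joint integrand in the parameter: `∂_σ [t² ρ(σt²)] = t⁴ ρ'(σt²)`. [folklore] -/
theorem fderiv_shellIntegrand_apply (hρ : ContDiff ℝ ∞ ρ) (t σ : ℝ) :
    fderiv ℝ (fun q : ℝ × ℝ => q.1 ^ 2 * ρ (q.2 * q.1 ^ 2)) (t, σ) ((0 : ℝ), (1 : ℝ)) =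
      t ^ 4 * deriv ρ (σ * t ^ 2) := by
  set H : ℝ × ℝ → ℝ := fun q => q.1 ^ 2 * ρ (q.2 * q.1 ^ 2) with hH
  have hHd : DifferentiableAt ℝ H (t, σ) := (contDiff_shellIntegrand hρ).differentiable (by simp) (t, σ)
  -- restrict `H` to the line `s ↦ (t, s)`
  have hpair : HasDerivAt (fun s : ℝ => ((t, s) : ℝ × ℝ)) ((0 : ℝ), (1 : ℝ)) σ :=
    (hasDerivAt_const σ t).prodMk (hasDerivAt_id σ)
  have h1 : HasDerivAt (H ∘ fun s : ℝ => ((t, s) : ℝ × ℝ)) (fderiv ℝ H (t, σ) ((0 : ℝ), (1 : ℝ))) σ :=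
    hHd.hasFDerivAt.comp_hasDerivAt σ hpair
  -- and differentiate the restriction directly
  have hρd : Differentiable ℝ ρ := hρ.differentiable (by simp)
  have h2 : HasDerivAt (fun s : ℝ => t ^ 2 * ρ (s * t ^ 2)) (t ^ 2 * (deriv ρ (σ * t ^ 2) * (1 * t ^ 2))) σ :=
    (((hρd (σ * t ^ 2)).hasDerivAt).comp σ ((hasDerivAt_id σ).mul_const (t ^ 2))).const_mul (t ^ 2)
  have h12 : (H ∘ fun s : ℝ => ((t, s) : ℝ × ℝ)) = fun s : ℝ => t ^ 2 * ρ (s * t ^ 2) := by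
    funext s
    simp [hH]
  rw [h12] at h1
  have := h1.unique h2
  rw [this]
  ring

/-- **Derivative of the shell transform**: `h'(σ) = ½ ∫₀¹ t⁴ ρ'(σt²) dt` (one derivative under the integral sign, tree
`fderiv_parametric_intervalIntegral_apply`). [folklore] -/
theorem deriv_shellTransform (hρ : ContDiff ℝ ∞ ρ)
    (hh : h = fun σ => 2⁻¹ * ∫ t in (0 : ℝ)..1, t ^ 2 * ρ (σ * t ^ 2)) (σ : ℝ) :
    deriv h σ = 2⁻¹ * ∫ t in (0 : ℝ)..1, t ^ 4 * deriv ρ (σ * t ^ 2) := by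
  have hH := contDiff_shellIntegrand hρ
  have hI : Differentiable ℝ fun s : ℝ => ∫ t in (0 : ℝ)..1, (fun q : ℝ × ℝ => q.1 ^ 2 * ρ (q.2 * q.1 ^ 2)) (t, s) :=
    differentiable_parametric_intervalIntegral hH (by simp) 0 1
  rw [hh, deriv_const_mul _ (hI σ)]
  congr 1
  rw [← fderiv_apply_one_eq_deriv, fderiv_parametric_intervalIntegral_apply hH (by simp) 0 1 σ 1]
  exact intervalIntegral.integral_congr fun t _ => fderiv_shellIntegrand_apply hρ t σ

/-- **The radial Poisson equation for the shell transform**: `4σ h'(σ) + 6 h(σ) = ρ(σ)` for every `σ ∈ ℝ`.  The integrand of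
`4σ h' + 6 h = ∫₀¹ (2σ t⁴ ρ'(σt²) + 3 t² ρ(σt²)) dt` is the `t`-derivative of `t³ ρ(σt²)`, whose values at `t = 1, 0` are `ρ(σ), 0`
(this is `Ψ'' + (2/r)Ψ' = ρ` for `Ψ = g(r²)`, `g' = h`, i.e. `ΔΨ = ρ(|x|²)` in `ℝ³`). [folklore] -/
theorem shellTransform_ode (hρ : ContDiff ℝ ∞ ρ)
    (hh : h = fun σ => 2⁻¹ * ∫ t in (0 : ℝ)..1, t ^ 2 * ρ (σ * t ^ 2)) (σ : ℝ) :
    4 * σ * deriv h σ + 6 * h σ = ρ σ := by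
  have hρd : Differentiable ℝ ρ := hρ.differentiable (by simp)
  have hρc : Continuous ρ := hρ.continuous
  have hρ'c : Continuous (deriv ρ) := hρ.continuous_deriv (by simp)
  rw [deriv_shellTransform hρ hh σ, hh]
  simp only
  -- the primitive `Φ(t) = t³ ρ(σt²)` and its derivative
  have hΦ : ∀ t : ℝ, HasDerivAt (fun t : ℝ => t ^ 3 * ρ (σ * t ^ 2))
      (3 * t ^ 2 * ρ (σ * t ^ 2) + t ^ 3 * (deriv ρ (σ * t ^ 2) * (σ * (2 * t)))) t := by
    intro t
    have h1 : HasDerivAt (fun t : ℝ => σ * t ^ 2) (σ * (2 * t)) t := by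
      have := (hasDerivAt_pow 2 t).const_mul σ
      simpa using this
    have h2 : HasDerivAt (fun t : ℝ => ρ (σ * t ^ 2)) (deriv ρ (σ * t ^ 2) * (σ * (2 * t))) t :=
      (hρd (σ * t ^ 2)).hasDerivAt.comp t h1
    have h3 : HasDerivAt (fun t : ℝ => t ^ 3) (3 * t ^ 2) t := by
      have := hasDerivAt_pow 3 t
      simpa using this
    exact h3.mul h2
  have hcont1 : Continuous fun t : ℝ => t ^ 4 * deriv ρ (σ * t ^ 2) :=
    (continuous_pow 4).mul (hρ'c.comp (continuous_const.mul (continuous_pow 2)))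
  have hcont2 : Continuous fun t : ℝ => t ^ 2 * ρ (σ * t ^ 2) :=
    (continuous_pow 2).mul (hρc.comp (continuous_const.mul (continuous_pow 2)))
  have hcont3 : Continuous fun t : ℝ =>
      3 * t ^ 2 * ρ (σ * t ^ 2) + t ^ 3 * (deriv ρ (σ * t ^ 2) * (σ * (2 * t))) :=
    ((continuous_const.mul (continuous_pow 2)).mul (hρc.comp (continuous_const.mul (continuous_pow 2)))).add
      ((continuous_pow 3).mul ((hρ'c.comp (continuous_const.mul (continuous_pow 2))).mul
        (continuous_const.mul (continuous_const.mul continuous_id))))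
  have hftc := intervalIntegral.integral_eq_sub_of_hasDerivAt (a := (0 : ℝ)) (b := 1)
    (fun t _ => hΦ t) (hcont3.intervalIntegrable _ _)
  simp only [one_pow, mul_one, one_mul, ne_eq, OfNat.ofNat_ne_zero, not_false_eq_true, zero_pow,
    mul_zero, zero_mul, sub_zero] at hftc
  -- `4σ h' + 6 h` is the integral of that derivative
  calc 4 * σ * (2⁻¹ * ∫ t in (0 : ℝ)..1, t ^ 4 * deriv ρ (σ * t ^ 2)) +
        6 * (2⁻¹ * ∫ t in (0 : ℝ)..1, t ^ 2 * ρ (σ * t ^ 2))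
      = (∫ t in (0 : ℝ)..1, 2 * σ * (t ^ 4 * deriv ρ (σ * t ^ 2))) +
          ∫ t in (0 : ℝ)..1, 3 * (t ^ 2 * ρ (σ * t ^ 2)) := by
        rw [intervalIntegral.integral_const_mul, intervalIntegral.integral_const_mul]
        ring
    _ = ∫ t in (0 : ℝ)..1, (2 * σ * (t ^ 4 * deriv ρ (σ * t ^ 2)) + 3 * (t ^ 2 * ρ (σ * t ^ 2))) :=
        (intervalIntegral.integral_add ((continuous_const.mul hcont1).intervalIntegrable _ _)
          ((continuous_const.mul hcont2).intervalIntegrable _ _)).symm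
    _ = ∫ t in (0 : ℝ)..1, (3 * t ^ 2 * ρ (σ * t ^ 2) + t ^ 3 * (deriv ρ (σ * t ^ 2) * (σ * (2 * t)))) :=
        intervalIntegral.integral_congr fun t _ => by ring
    _ = ρ σ := hftc

/-- The shell transform of a nonnegative density is nonnegative. [folklore] -/
theorem shellTransform_nonneg (hρ0 : ∀ s, 0 ≤ ρ s)
    (hh : h = fun σ => 2⁻¹ * ∫ t in (0 : ℝ)..1, t ^ 2 * ρ (σ * t ^ 2)) (σ : ℝ) : 0 ≤ h σ := by
  rw [hh]
  exact mul_nonneg (by norm_num) (intervalIntegral.integral_nonneg zero_le_one fun t _ =>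
    mul_nonneg (sq_nonneg t) (hρ0 _))

/-- **Comparison with the shell mean of the profile**: if `ρ ≤ (1+·)^{−β/2}` on `[0, ∞)` then for `σ ≥ 0`,
`2 h(σ) ≤ ∫₀¹ t² (1+σt²)^{−β/2} dt` (the quantity bounded in brick 1, `shellMean_upper`). [folklore] -/
theorem two_mul_shellTransform_le_shellMean {β : ℝ} (hρc : Continuous ρ)
    (hρW : ∀ s, 0 ≤ s → ρ s ≤ (1 + s) ^ (-(β / 2)))
    (hh : h = fun σ => 2⁻¹ * ∫ t in (0 : ℝ)..1, t ^ 2 * ρ (σ * t ^ 2)) {σ : ℝ} (hσ : 0 ≤ σ) :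
    2 * h σ ≤ ∫ t in (0 : ℝ)..1, t ^ 2 * (1 + σ * t ^ 2) ^ (-(β / 2)) := by
  rw [hh]
  simp only
  rw [← mul_assoc, mul_inv_cancel₀ two_ne_zero, one_mul]
  have hbase : ∀ t : ℝ, 0 < 1 + σ * t ^ 2 := fun t => by
    have := mul_nonneg hσ (sq_nonneg t); linarith
  have hcont : Continuous fun t : ℝ => t ^ 2 * (1 + σ * t ^ 2) ^ (-(β / 2)) :=
    (continuous_pow 2).mul ((continuous_const.add (continuous_const.mul (continuous_pow 2))).rpow_const
      fun t => Or.inl (hbase t).ne')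
  have hcont2 : Continuous fun t : ℝ => t ^ 2 * ρ (σ * t ^ 2) :=
    (continuous_pow 2).mul (hρc.comp (continuous_const.mul (continuous_pow 2)))
  refine intervalIntegral.integral_mono_on zero_le_one (hcont2.intervalIntegrable _ _)
    (hcont.intervalIntegrable _ _) fun t _ => ?_
  exact mul_le_mul_of_nonneg_left (hρW _ (mul_nonneg hσ (sq_nonneg t))) (sq_nonneg t)

/-- **On `[0, R²]` the shell transform IS the shell mean of the profile**: if `ρ = (1+·)^{−β/2}` on `[0, R²]` then for
`0 ≤ σ ≤ R²`, `2 h(σ) = ∫₀¹ t² (1+σt²)^{−β/2} dt` (for `t ∈ [0,1]`, `σt² ∈ [0, R²]`). [folklore] -/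
theorem two_mul_shellTransform_eq_shellMean {β R : ℝ}
    (hρW : ∀ s, 0 ≤ s → s ≤ R ^ 2 → ρ s = (1 + s) ^ (-(β / 2)))
    (hh : h = fun σ => 2⁻¹ * ∫ t in (0 : ℝ)..1, t ^ 2 * ρ (σ * t ^ 2)) {σ : ℝ} (hσ : 0 ≤ σ)
    (hσR : σ ≤ R ^ 2) :
    2 * h σ = ∫ t in (0 : ℝ)..1, t ^ 2 * (1 + σ * t ^ 2) ^ (-(β / 2)) := by
  rw [hh]
  simp only
  rw [← mul_assoc, mul_inv_cancel₀ two_ne_zero, one_mul]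
  refine intervalIntegral.integral_congr fun t ht => ?_
  rw [uIcc_of_le zero_le_one, mem_Icc] at ht
  have ht2 : t ^ 2 ≤ 1 := by nlinarith [ht.1, ht.2]
  have h0 : 0 ≤ σ * t ^ 2 := mul_nonneg hσ (sq_nonneg t)
  have h1 : σ * t ^ 2 ≤ R ^ 2 := by nlinarith
  rw [hρW _ h0 h1]

/-- **Crude bound**: if `0 ≤ ρ ≤ 1` on `[0, ∞)` then `h(σ) ≤ 1/6` for `σ ≥ 0` (`½ ∫₀¹ t² dt = 1/6`). [folklore] -/
theorem shellTransform_le_sixth (hρc : Continuous ρ) (hρ1 : ∀ s, 0 ≤ s → ρ s ≤ 1)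
    (hh : h = fun σ => 2⁻¹ * ∫ t in (0 : ℝ)..1, t ^ 2 * ρ (σ * t ^ 2)) {σ : ℝ} (hσ : 0 ≤ σ) :
    h σ ≤ 1 / 6 := by
  rw [hh]
  simp only
  have hcont2 : Continuous fun t : ℝ => t ^ 2 * ρ (σ * t ^ 2) :=
    (continuous_pow 2).mul (hρc.comp (continuous_const.mul (continuous_pow 2)))
  have hle : (∫ t in (0 : ℝ)..1, t ^ 2 * ρ (σ * t ^ 2)) ≤ ∫ t in (0 : ℝ)..1, t ^ 2 := by
    refine intervalIntegral.integral_mono_on zero_le_one (hcont2.intervalIntegrable _ _)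
      ((continuous_pow 2).intervalIntegrable _ _) fun t _ => ?_
    calc t ^ 2 * ρ (σ * t ^ 2) ≤ t ^ 2 * 1 :=
          mul_le_mul_of_nonneg_left (hρ1 _ (mul_nonneg hσ (sq_nonneg t))) (sq_nonneg t)
      _ = t ^ 2 := mul_one _
  rw [integral_pow] at hle
  norm_num at hle
  linarith

end ShellTransform

end Summit.NavierStokesRegularity.NavierStokesRegularity.Theorems.PowerGaugeEulerLiouville.PressureFloor

end
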